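import Summits.Schanuel.Schanuel.Theorems.RootDecomp1BDefectFloorCellsPi
import Literature.NumberTheory.Transcendental.DiazLadder

/-!
# RootDecomp1B — gen 12 «ABSORPTION» (lens 4, minimal counterexample / extremal reduction)

Lens-4 theorem round 12 on route `RootDecomp1B` (rev 30; X = `KleinPolarSchanuel` 24622; seven open
first-failure cruxes LSB 27214 · Free 28104 · Tight 29188 · SRL 32406 · T0 32407 · W0 32408 · WAS 32144 (residual)).
No item, no split, no `closes` change.  Three kernel facts about the EXTREMAL structure of the normal form:

* §1 ABSORPTION (`le_polarDeg_of_kleinIH`): at a first-failure cell of length `m + 1` the structural hypotheses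
  (`ℚ`-free + `KleinIH (m+1)`) already certify `t(r) ≥ 2m`.  Consequently a transcendence theorem asserting
  `trdeg ≥ k` with `k ≤ 2m` for a sub-configuration of the cell can never DECIDE the cell: it is absorbed by the
  hypotheses.  This is the precise reason why the partial-transcendence ladder (Gel'fond 1949, Chudnovsky, Philippon,
  Diaz 1989: `⌊(d+1)/2⌋` of `d - 1`; Brownawell–Waldschmidt; six exponentials) decides NO cell of SRL/T0/W0/SD0/TC/JI
  at any storey `≥ 1`, while the only decided cells are those whose hypotheses are themselves full-strength theorems
  (Lindemann–Weierstrass bases, the Nesterenko base `(π)`).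
* §2 CHEAP ENLARGEMENT (`polarDeg_le_init_add_two_of_closed_channel`, `polarDeg_lt_of_init_lt_of_closed_channel`,
  `kleinPolarAt_init_of_closed_channel`): appending a real number ONE OF WHOSE THREE CHANNELS `u, e^u, e^{iu}` is
  algebraic over the polar field `F(r')` raises `t` by at most `2`; hence a Klein–polar COUNTEREXAMPLE stays a
  counterexample under every such «cheap» enlargement (tame enrichment by algebraic numbers, `log α`, `qπ`;
  `K`-scaling `r ↦ (r, θ r)` for real algebraic `θ`; exponential / logarithmic / phase chains `u ↦ e^u`, …).  These are
  the lens's δ-monotone moves: every normal form reachable by cheap moves is free («WLOG the counterexample contains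
  `K`, is `K`-stable, contains `1, e, e^e, …`»), as a GLOBAL equivalence `X ⟺ X^N`.  (Prose corollary, NODE.md §3:
  such normal forms do NOT thread through the first-failure induction — they destroy minimality — which is why they
  cannot convert first-failure TYPES and why none of them meets rule F2⁗.)
* §3 HALF-SCHANUEL ON A `K`-STABLE LOGARITHMIC PAIR (`two_le_polarDeg_logPair`): for every real algebraic
  `x > 0, x ≠ 1`, the Klein–polar pair `r = (log x · √2/2, log x)` has `t(r) ≥ 2` (X demands `4`) — UNCONDITIONALLY,
  MOD the tree's named fact `diaz_1989` (Diaz 1989 Cor. 2 = LNM 1752 Ch. 14 Cor. 2.8; DISCHARGED in tree: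
  `Literature.NumberTheory.Transcendental.diaz_1989_holds`, `DiazLadderHolds.lean` — taken here as a hypothesis only to keep
  this file's import cone inside the farm snapshot) applied
  with `β = ζ₈` (degree `4`, `ℚ(ζ₈) = ℚ(√2, i)`): the three Diaz generators `x^{ζ₈}, x^{ζ₈²} = x^{i}, x^{ζ₈³}` lie
  in the polar field of `r`.  This is the FIRST certified `trdeg ≥ 2` for a Klein–polar tuple of the logarithmic
  (B1) class — each coordinate's own storey-0 cell X(1) («`log x, x^{i}` alg. independent», «`log x·√2/2,
  x^{√2/2}, x^{i√2/2}`: two alg. independent») is OPEN — and, by §1, it is exactly ABSORBED at the storey-1 cell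
  `(log x·√2/2 ∣ log x)` (hypothesis `t(r') = 2`, conclusion `t(r) ≥ 3` (SRL) / `≥ 4` (SD0)): the kernel instance of
  barrier B3 (`Literature.Barriers.Schanuel.LargeTranscendenceDegree`) INSIDE the route's own currency.

Imports: the landed `RootDecomp1BDefectFloorCellsPi` (polar-flag bookkeeping `polarDeg_le_init_add_of_algebraic`,
`lastGens`, …; transitively `RootDecomp1BFedFlag{Defs,Core}`, `RootDecomp1BTameFlagCore`) and the STATEMENT file of the
Diaz ladder (`DiazLadder.lean`; the discharge `diaz_1989_holds` lives in `DiazLadderHolds.lean`).  Landed declarations are CALLED, never restated; sorry-free; standard axioms.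
-/

open Complex IntermediateField
open Literature.NumberTheory.Transcendental (diaz_1989)
open Literature.NumberTheory.Transcendental.OneMotiveToric (trdeg_mono)

namespace Summit.Schanuel.Schanuel.Theorems.RootDecomp1BAbsorption

set_option linter.dupNamespace false

open Summit.Schanuel.Schanuel.Theorems.RootDecomp1BFedFlagCore
open Summit.Schanuel.Schanuel.Theorems.RootDecomp1BTameFlagCore
open Summit.Schanuel.Schanuel.Theorems.RootDecomp1BDefectFloorDefs
open Summit.Schanuel.Schanuel.Theorems.RootDecomp1BDefectFloorCells

noncomputable section

/-! ## §1 Absorption — what the hypotheses of a first-failure cell already certify -/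

section Absorption

variable {m : ℕ}

/-- **ABSORPTION.** At a cell of length `m + 1` (`r` `ℚ`-free, Klein–polar Schanuel below length `m + 1`), every bound
`t(r) ≥ n` with `n ≤ 2m` is FREE: `t(r) ≥ t(Fin.init r) ≥ 2m`.  A transcendence theorem whose output is `≤ 2m`
algebraically independent numbers inside the cell therefore decides nothing about the cell. -/
theorem le_polarDeg_of_kleinIH {r : Fin (m + 1) → ℝ} (hr : LinearIndependent ℚ r) (hIH : KleinIH (m + 1))
    {n : ℕ} (hn : n ≤ m + m) : ((n : ℕ) : Cardinal) ≤ polarDeg r :=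
  (((Nat.cast_le (α := Cardinal)).mpr hn).trans (two_mul_le_polarDeg_init hr hIH)).trans (polarDeg_init_le r)

/-- Absorption, sharp form: over a SHARP base (`t(r') ≤ 2m`, the regime of SRL/T0/W0/SD0) the hypotheses pin
`t(Fin.init r) = 2m` exactly, so the cell's content is entirely the `(2m+1)`-st (floor) / `(2m+2)`-nd (defect zero)
algebraically independent number. -/
theorem polarDeg_init_eq_of_sharp {r : Fin (m + 1) → ℝ} (hr : LinearIndependent ℚ r) (hIH : KleinIH (m + 1))
    (hsharp : polarDeg (Fin.init r) ≤ ((m + m : ℕ) : Cardinal)) :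
    polarDeg (Fin.init r) = ((m + m : ℕ) : Cardinal) :=
  le_antisymm hsharp (two_mul_le_polarDeg_init hr hIH)

end Absorption

/-! ## §2 Cheap enlargement — counterexamples persist under every δ-monotone move -/

section Cheap

variable {m : ℕ}

/-- Elements of a generating set are algebraic over the generated field. [folklore; private twin of landed copies] -/
private theorem isAlgebraic_of_mem_gens' {S : Set ℂ} {x : ℂ} (hx : x ∈ S) :
    IsAlgebraic ↥(adjoin ℚ S) x := by
  have hx' : x ∈ adjoin ℚ S := subset_adjoin ℚ S hx
  exact isAlgebraic_algebraMap (⟨x, hx'⟩ : ↥(adjoin ℚ S))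

/-- `CheapOver r`: the LAST coordinate `u` of `r` has a CLOSED CHANNEL over the polar field of the initial hyperplane:
one of `u`, `e^u`, `e^{iu}` is algebraic over `F(Fin.init r)`.  (Algebraic `u`; `u = log α`, `qπ`, `arg γ`;
`u = θ · r_j` with `θ` real algebraic; `u = e^{r_j}`, `u = log r_j`, … are all cheap.) -/
def CheapOver (r : Fin (m + 1) → ℝ) : Prop :=
  IsAlgebraic ↥(polarField (Fin.init r)) ((r (Fin.last m) : ℝ) : ℂ) ∨
    IsAlgebraic ↥(polarField (Fin.init r)) (Complex.exp ((r (Fin.last m) : ℝ) : ℂ)) ∨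
      IsAlgebraic ↥(polarField (Fin.init r)) (Complex.exp (((r (Fin.last m) : ℝ) : ℂ) * Complex.I))

set_option synthInstance.maxHeartbeats 200000 in
/-- **CHEAP ENLARGEMENT.** A closed channel costs at most two: `t(r) ≤ t(Fin.init r) + 2`. -/
theorem polarDeg_le_init_add_two_of_closed_channel (r : Fin (m + 1) → ℝ) (h : CheapOver r) :
    polarDeg r ≤ polarDeg (Fin.init r) + ((2 : ℕ) : Cardinal) := by
  rcases h with hu | he | hp
  · -- coordinate channel closed: adjoin only `e^u, e^{iu}`
    have h := polarDeg_le_init_add_of_algebraic r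
      (Set.range ![Complex.exp ((r (Fin.last m) : ℝ) : ℂ), Complex.exp (((r (Fin.last m) : ℝ) : ℂ) * Complex.I)]) ?_
    · exact h.trans (add_le_add le_rfl (Cardinal.mk_range_le.trans (by simp)))
    · have hle : polarField (Fin.init r) ≤ adjoin ℚ (polarGens (Fin.init r) ∪
          Set.range ![Complex.exp ((r (Fin.last m) : ℝ) : ℂ), Complex.exp (((r (Fin.last m) : ℝ) : ℂ) * Complex.I)]) :=
        adjoin.mono ℚ _ _ Set.subset_union_left
      intro x hx
      simp only [lastGens, Set.mem_insert_iff, Set.mem_singleton_iff] at hx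
      rcases hx with rfl | rfl | rfl | rfl
      · exact isAlgebraic_of_le hle hu
      · exact (isAlgebraic_of_le hle hu).mul (isAlgebraic_I _)
      · exact isAlgebraic_of_mem_gens' (Or.inr ⟨0, rfl⟩)
      · exact isAlgebraic_of_mem_gens' (Or.inr ⟨1, rfl⟩)
  · -- modulus channel closed: adjoin only `u, e^{iu}`
    have h := polarDeg_le_init_add_of_algebraic r
      (Set.range ![((r (Fin.last m) : ℝ) : ℂ), Complex.exp (((r (Fin.last m) : ℝ) : ℂ) * Complex.I)]) ?_
    · exact h.trans (add_le_add le_rfl (Cardinal.mk_range_le.trans (by simp)))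
    · have hle : polarField (Fin.init r) ≤ adjoin ℚ (polarGens (Fin.init r) ∪
          Set.range ![((r (Fin.last m) : ℝ) : ℂ), Complex.exp (((r (Fin.last m) : ℝ) : ℂ) * Complex.I)]) :=
        adjoin.mono ℚ _ _ Set.subset_union_left
      intro x hx
      simp only [lastGens, Set.mem_insert_iff, Set.mem_singleton_iff] at hx
      rcases hx with rfl | rfl | rfl | rfl
      · exact isAlgebraic_of_mem_gens' (Or.inr ⟨0, rfl⟩)
      · exact (isAlgebraic_of_mem_gens' (Or.inr ⟨0, rfl⟩)).mul (isAlgebraic_I _)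
      · exact isAlgebraic_of_le hle he
      · exact isAlgebraic_of_mem_gens' (Or.inr ⟨1, rfl⟩)
  · -- phase channel closed: adjoin only `u, e^{u}`
    have h := polarDeg_le_init_add_of_algebraic r
      (Set.range ![((r (Fin.last m) : ℝ) : ℂ), Complex.exp ((r (Fin.last m) : ℝ) : ℂ)]) ?_
    · exact h.trans (add_le_add le_rfl (Cardinal.mk_range_le.trans (by simp)))
    · have hle : polarField (Fin.init r) ≤ adjoin ℚ (polarGens (Fin.init r) ∪
          Set.range ![((r (Fin.last m) : ℝ) : ℂ), Complex.exp ((r (Fin.last m) : ℝ) : ℂ)]) :=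
        adjoin.mono ℚ _ _ Set.subset_union_left
      intro x hx
      simp only [lastGens, Set.mem_insert_iff, Set.mem_singleton_iff] at hx
      rcases hx with rfl | rfl | rfl | rfl
      · exact isAlgebraic_of_mem_gens' (Or.inr ⟨0, rfl⟩)
      · exact (isAlgebraic_of_mem_gens' (Or.inr ⟨0, rfl⟩)).mul (isAlgebraic_I _)
      · exact isAlgebraic_of_mem_gens' (Or.inr ⟨1, rfl⟩)
      · exact isAlgebraic_of_le hle hp

/-- **COUNTEREXAMPLES PERSIST UNDER CHEAP ENLARGEMENT** (δ-monotonicity): if the initial hyperplane violates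
Klein–polar Schanuel (`t(r') < 2m`) and the new coordinate is cheap, then `r` violates it too (`t(r) < 2m + 2`). -/
theorem polarDeg_lt_of_init_lt_of_closed_channel (r : Fin (m + 1) → ℝ) (h : CheapOver r)
    (hlt : polarDeg (Fin.init r) < ((m + m : ℕ) : Cardinal)) :
    polarDeg r < ((m + 1 + (m + 1) : ℕ) : Cardinal) := by
  obtain ⟨n', hn'⟩ := Cardinal.lt_aleph0.mp (polarDeg_lt_aleph0 (Fin.init r))
  have hle := polarDeg_le_init_add_two_of_closed_channel r h
  rw [hn'] at hlt hle
  have hlt' : n' < m + m := by exact_mod_cast hlt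
  have hle' : polarDeg r ≤ ((n' + 2 : ℕ) : Cardinal) := by
    simpa only [Nat.cast_add] using hle
  exact hle'.trans_lt (by exact_mod_cast (by omega : n' + 2 < m + 1 + (m + 1)))

/-- The same fact read downwards (**normal-form transfer**): Klein–polar Schanuel at a cheaply ENLARGED tuple gives it
at the original tuple.  Hence, for every normal form `N` reachable from any tuple by cheap moves (starts with a fixed
`ℚ`-free algebraic block; `θ`-stable span for a real algebraic `θ`; contains `1, e, e^e, …, exp^{(L)}(1)`; …),
`X ⟺ X` restricted to `N` — as a GLOBAL equivalence (NODE.md §3 explains why it does not thread through the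
first-failure induction). -/
theorem kleinPolarAt_init_of_closed_channel (r : Fin (m + 1) → ℝ) (h : CheapOver r)
    (hX : ((m + 1 + (m + 1) : ℕ) : Cardinal) ≤ polarDeg r) :
    ((m + m : ℕ) : Cardinal) ≤ polarDeg (Fin.init r) := by
  by_contra hlt
  exact (not_le.mpr (polarDeg_lt_of_init_lt_of_closed_channel r h (not_le.mp hlt))) hX

/-- Algebraic last coordinates are cheap (tame enrichment by a real algebraic number; the `K`-scaling move
`u = θ · r_j` is the case `u ∈ ℚ̄ · r_j ⊆ acl F(r')`). -/
theorem cheapOver_of_isAlgebraic (r : Fin (m + 1) → ℝ) (h : IsAlgebraic ℚ ((r (Fin.last m) : ℝ) : ℂ)) :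
    CheapOver r :=
  Or.inl (h.tower_top _)

/-- A last coordinate whose exponential is algebraic (`u = log α`) is cheap. -/
theorem cheapOver_of_isAlgebraic_exp (r : Fin (m + 1) → ℝ)
    (h : IsAlgebraic ℚ (Complex.exp ((r (Fin.last m) : ℝ) : ℂ))) : CheapOver r :=
  Or.inr (Or.inl (h.tower_top _))

/-- A last coordinate whose phase is algebraic (`u = qπ`, `u = arg γ`) is cheap. -/
theorem cheapOver_of_isAlgebraic_exp_mul_I (r : Fin (m + 1) → ℝ)
    (h : IsAlgebraic ℚ (Complex.exp (((r (Fin.last m) : ℝ) : ℂ) * Complex.I))) : CheapOver r :=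
  Or.inr (Or.inr (h.tower_top _))

/-- The exponential chain move is cheap: if `u = e^{r_j}` for an earlier coordinate `r_j`, the coordinate channel
of `u` lies IN `F(r')`. -/
theorem cheapOver_of_eq_exp (r : Fin (m + 1) → ℝ) (j : Fin m) (h : r (Fin.last m) = Real.exp (r (Fin.castSucc j))) :
    CheapOver r := by
  refine Or.inl ?_
  have hmem : ((r (Fin.last m) : ℝ) : ℂ) ∈ polarField (Fin.init r) := by
    rw [h, Complex.ofReal_exp]
    exact exp_coe_mem_polarField (Fin.init r) j
  exact isAlgebraic_algebraMap (⟨_, hmem⟩ : ↥(polarField (Fin.init r)))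

end Cheap

/-! ## §3 Half-Schanuel on a `K`-stable logarithmic pair (Diaz 1989 with `β = ζ₈`) -/

section Half

/-- `ζ₈ = e^{2πi/8}`. -/
def zeta8 : ℂ := Complex.exp (2 * Real.pi * Complex.I / (8 : ℕ))

/-- `ζ₈ = √2/2 + (√2/2) i`. -/
theorem zeta8_eq : zeta8 = ((Real.sqrt 2 / 2 : ℝ) : ℂ) + ((Real.sqrt 2 / 2 : ℝ) : ℂ) * Complex.I := by
  have harg : (2 * (Real.pi : ℂ) * Complex.I / ((8 : ℕ) : ℂ)) = ((Real.pi / 4 : ℝ) : ℂ) * Complex.I := by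
    push_cast; ring
  rw [zeta8, harg, Complex.exp_mul_I, ← Complex.ofReal_cos, ← Complex.ofReal_sin, Real.cos_pi_div_four,
    Real.sin_pi_div_four]

/-- `(√2/2)² = 1/2` in `ℂ`. -/
theorem sqrt_two_div_two_sq : (((Real.sqrt 2 / 2 : ℝ) : ℂ)) ^ 2 = 1 / 2 := by
  have hreal : (Real.sqrt 2 / 2 : ℝ) ^ 2 = 1 / 2 := by
    rw [div_pow, Real.sq_sqrt (by norm_num)]; norm_num
  have := congrArg (fun t : ℝ => (t : ℂ)) hreal
  push_cast at this
  simpa using this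

/-- `ζ₈² = i`. -/
theorem zeta8_sq : zeta8 ^ 2 = Complex.I := by
  rw [zeta8_eq]
  linear_combination (1 + 2 * Complex.I + Complex.I ^ 2) * sqrt_two_div_two_sq + (1 / 2 : ℂ) * Complex.I_sq

/-- `ζ₈³ = -√2/2 + (√2/2) i`. -/
theorem zeta8_cube : zeta8 ^ 3 = -((Real.sqrt 2 / 2 : ℝ) : ℂ) + ((Real.sqrt 2 / 2 : ℝ) : ℂ) * Complex.I := by
  rw [pow_succ, zeta8_sq, zeta8_eq]
  linear_combination (((Real.sqrt 2 / 2 : ℝ) : ℂ)) * Complex.I_sq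

/-- `ζ₈` has degree `4` over `ℚ` (`Φ₈ = X⁴ + 1`). -/
theorem natDegree_minpoly_zeta8 : (minpoly ℚ zeta8).natDegree = 4 := by
  have h8 : IsPrimitiveRoot zeta8 8 := Complex.isPrimitiveRoot_exp 8 (by norm_num)
  rw [← Polynomial.cyclotomic_eq_minpoly_rat h8 (by norm_num), Polynomial.natDegree_cyclotomic]
  decide

/-- The `K`-stable logarithmic pair `r = (log x · √2/2, log x)` (`K = ℚ(√2)`; span `= ℚ(√2) · log x`). -/
def logPair (x : ℝ) : Fin 2 → ℝ := ![Real.log x * (Real.sqrt 2 / 2), Real.log x]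

/-- First coordinate of `logPair x`. -/
@[simp] theorem logPair_zero (x : ℝ) : logPair x 0 = Real.log x * (Real.sqrt 2 / 2) := rfl
/-- Second coordinate of `logPair x`. -/
@[simp] theorem logPair_one (x : ℝ) : logPair x 1 = Real.log x := rfl

/-- The three Diaz generators `x^{ζ₈^{k+1}}` (`k < 3`) lie in the polar field of the pair. -/
theorem diazGens_subset_polarField (x : ℝ) :
    Set.range (fun k : Fin (4 - 1) => Complex.exp (zeta8 ^ (k.val + 1) * ((Real.log x : ℝ) : ℂ))) ⊆
      (polarField (logPair x) : Set ℂ) := by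
  rintro _ ⟨⟨k, hk⟩, rfl⟩
  have hk3 : k = 0 ∨ k = 1 ∨ k = 2 := by omega
  rcases hk3 with rfl | rfl | rfl
  · -- ζ₈ · log x = (log x·√2/2) + (log x·√2/2) i
    have e0 : zeta8 ^ (0 + 1) * ((Real.log x : ℝ) : ℂ) =
        ((logPair x 0 : ℝ) : ℂ) + ((logPair x 0 : ℝ) : ℂ) * Complex.I := by
      rw [zero_add, pow_one, zeta8_eq, logPair_zero]; push_cast; ring
    show Complex.exp (zeta8 ^ (0 + 1) * ((Real.log x : ℝ) : ℂ)) ∈ polarField (logPair x)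
    rw [e0, Complex.exp_add]
    exact mul_mem (exp_coe_mem_polarField (logPair x) 0) (exp_coe_mul_I_mem_polarField (logPair x) 0)
  · -- ζ₈² · log x = i log x
    have e1 : zeta8 ^ (1 + 1) * ((Real.log x : ℝ) : ℂ) = ((logPair x 1 : ℝ) : ℂ) * Complex.I := by
      rw [show (1 + 1 : ℕ) = 2 from rfl, zeta8_sq, logPair_one]; ring
    show Complex.exp (zeta8 ^ (1 + 1) * ((Real.log x : ℝ) : ℂ)) ∈ polarField (logPair x)
    rw [e1]
    exact exp_coe_mul_I_mem_polarField (logPair x) 1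
  · -- ζ₈³ · log x = -(log x·√2/2) + (log x·√2/2) i
    have e2 : zeta8 ^ (2 + 1) * ((Real.log x : ℝ) : ℂ) =
        -(((logPair x 0 : ℝ) : ℂ)) + ((logPair x 0 : ℝ) : ℂ) * Complex.I := by
      rw [show (2 + 1 : ℕ) = 3 from rfl, zeta8_cube, logPair_zero]; push_cast; ring
    show Complex.exp (zeta8 ^ (2 + 1) * ((Real.log x : ℝ) : ℂ)) ∈ polarField (logPair x)
    rw [e2, Complex.exp_add, Complex.exp_neg]
    exact mul_mem (inv_mem (exp_coe_mem_polarField (logPair x) 0)) (exp_coe_mul_I_mem_polarField (logPair x) 0)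

/-- **HALF-SCHANUEL ON THE `ℚ(√2)`-STABLE LOGARITHMIC PAIR.**  For every real algebraic `x > 0`, `x ≠ 1`:
`t(log x·√2/2, log x) = trdeg_ℚ ℚ(log x, x^{√2/2}, x^{i}, x^{i√2/2}) ≥ 2` — half of the `4` that Klein–polar
Schanuel X demands — mod the named fact `diaz_1989` (Diaz 1989 Cor. 2; discharged in tree as `diaz_1989_holds`) with `β = ζ₈` (degree `4`,
`⌊5/2⌋ = 2`), whose generators `x^{ζ₈}, x^{ζ₈²}, x^{ζ₈³}` lie in the polar field (`diazGens_subset_polarField`).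
Each coordinate's own storey-0 cell is OPEN («`log x, x^{i}` algebraically independent» = X(1) = JI(0) at `log x`);
the bound is ABSORBED at the storey-1 cell (§1): the kernel face of barrier B3 inside the route's currency.
[cite: NesterenkoPhilippon2001, Ch. 14 Corollary 2.8 (p. 216)] [cite: Diaz1989, Corollaire 2] -/
theorem two_le_polarDeg_logPair (hD : diaz_1989) (x : ℝ) (hx : IsAlgebraic ℚ ((x : ℝ) : ℂ)) (h0 : 0 < x)
    (h1 : x ≠ 1) : ((2 : ℕ) : Cardinal) ≤ polarDeg (logPair x) := by
  have hexp : Complex.exp ((Real.log x : ℝ) : ℂ) = ((x : ℝ) : ℂ) := by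
    rw [← Complex.ofReal_exp, Real.exp_log h0]
  have hl : ((Real.log x : ℝ) : ℂ) ≠ 0 := by
    exact_mod_cast Real.log_ne_zero_of_pos_of_ne_one h0 h1
  have hD := hD ((x : ℝ) : ℂ) zeta8 ((Real.log x : ℝ) : ℂ) 4 hx natDegree_minpoly_zeta8
    (by norm_num) hexp hl
  have hmono : Algebra.trdeg ℚ ↥(adjoin ℚ (Set.range
      (fun k : Fin (4 - 1) => Complex.exp (zeta8 ^ (k.val + 1) * ((Real.log x : ℝ) : ℂ))))) ≤
      Algebra.trdeg ℚ ↥(polarField (logPair x)) :=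
    trdeg_mono (adjoin_le_iff.mpr (diazGens_subset_polarField x))
  have h2 : ((4 + 1) / 2 : ℕ) = 2 := by norm_num
  rw [h2] at hD
  exact hD.trans hmono

/-- The same in DEFECT currency: the pair's Klein–polar defect `4 - t` is at most `2` (the trivial bound from
Hermite–Lindemann alone is `3`). -/
theorem polarDeg_logPair_add_two_ge (hD : diaz_1989) (x : ℝ) (hx : IsAlgebraic ℚ ((x : ℝ) : ℂ)) (h0 : 0 < x)
    (h1 : x ≠ 1) : ((2 + 2 : ℕ) : Cardinal) ≤ polarDeg (logPair x) + ((2 : ℕ) : Cardinal) := by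
  have h := two_le_polarDeg_logPair hD x hx h0 h1
  calc ((2 + 2 : ℕ) : Cardinal) = ((2 : ℕ) : Cardinal) + ((2 : ℕ) : Cardinal) := by push_cast; ring
    _ ≤ polarDeg (logPair x) + ((2 : ℕ) : Cardinal) := add_le_add h le_rfl

/-- **ABSORBED.** At the storey-1 cell `(log x·√2/2 ∣ log x)` the structural hypotheses give the same `t ≥ 2` for free
(`le_polarDeg_of_kleinIH` with `m = 1`): Diaz's certificate sits exactly at the hypothesis level of the cell and below
its conclusions (`≥ 3` floor SRL, `≥ 4` defect zero SD0 = X(2)). -/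
theorem two_le_polarDeg_logPair_of_kleinIH (x : ℝ) (hr : LinearIndependent ℚ (logPair x)) (hIH : KleinIH 2) :
    ((2 : ℕ) : Cardinal) ≤ polarDeg (logPair x) :=
  le_polarDeg_of_kleinIH (m := 1) hr hIH le_rfl

end Half

end

end Summit.Schanuel.Schanuel.Theorems.RootDecomp1BAbsorption
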